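import Summits.Ventures.HSemireg.WedgeHankelRecurrenceGaussGegenbauerFullRange

/-!
# Venture HSemireg — **THE TRACE REARRANGEMENT INEQUALITY (BIRKHOFF–VON NEUMANN + REARRANGEMENT)**: for increasing `x, y : Fin n → ℝ` and a DOUBLY STOCHASTIC matrix `P`,
# **`Σ_{k,l} P_{kl} x_k y_l ≤ Σ_k x_k y_k`**; for an ORTHOGONAL matrix `M` (`M Mᵀ = 1`) the matrix of squared entries `(M_{kl}²)` is doubly stochastic, whence
# **`Σ_{k,l} M_{kl}² x_k y_l ≤ Σ_k x_k y_k`** — the finite-dimensional heart of the HOFFMAN–WIELANDT inequality (N417)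

HONEST FRAMING. Part of the Lean index of the computation cell `pub-hsemireg` (seat p10 gen 47, Sunday typer «UNIFORM-IN-n»).  Finite sums and real square matrices only (Mathlib's `doublyStochastic`,
Birkhoff's theorem `exists_eq_sum_perm_of_mem_doublyStochastic`, the rearrangement inequality `Monovary.sum_mul_comp_perm_le_sum_mul`); no variety, no cohomology theory, no sheaf, no Ext group
and no semiregularity map is constructed here; nothing here says that HC / HC_CM / HC_AV holds; no Literature fact (unproved `Prop`) is declared or used.  Custodian versions as in
`WedgeHankelSiegelIdeal` (1/3).
SOURCES (cited).  A. J. Hoffman, H. W. Wielandt, *The variation of the spectrum of a normal matrix*, Duke Math. J. 20 (1953) 37–39 (the proof via Birkhoff's theorem); G. Birkhoff, *Tres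
observaciones sobre el álgebra lineal*, Univ. Nac. Tucumán Rev. A 5 (1946) 147–151; G. H. Hardy, J. E. Littlewood, G. Pólya, *Inequalities* (1934), Thm 368 (rearrangement); R. Bhatia,
*Matrix Analysis* (1997), Thm VI.4.1 and Problem III.6.14; J. H. Wilkinson, *The Algebraic Eigenvalue Problem* (1965), Ch. 2 §48.
PROOF TYPED HERE.  `P = Σ_σ w_σ Perm_σ` (Mathlib Birkhoff), `Σ_{k,l} (Perm_σ)_{kl} x_k y_l = Σ_k x_k y_{σ k}`, Mathlib's rearrangement inequality for the monovarying pair `(x, y)`, convexity;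
for orthogonal `M` the row ∕ column sums of `M_{kl}²` are the diagonal entries of `M Mᵀ = 1` and `Mᵀ M = 1`.
DEDUP DISCLOSURE (`rg -n -i 'doublyStochastic|rearrangement|hoffman|wielandt' Summits/Ventures/HSemireg Literature`, 2026-09-04): the lineage has the `ℓ¹` ∕ `ℓ^∞` diagonal perturbation bounds
N387 ∕ N324 ∕ N354 (Weyl ∕ Lidskii type) but no doubly stochastic argument; 0 hits for the 4 names below.

WHAT IS IN THE TREE.  Mathlib `doublyStochastic`, `mem_doublyStochastic_iff_sum`, `exists_eq_sum_perm_of_mem_doublyStochastic`, `Equiv.Perm.permMatrix`, `PEquiv.toMatrix_apply`,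
`Monotone.monovary`, `Monovary.sum_mul_comp_perm_le_sum_mul`.
THIS FILE (namespace `Summit.Ventures.HSemireg.Wedge.HankelOuter` continued; CHAINED on N414 (import only); 0 definitions):
* §1180 `sum_permMatrix_mul_mul` (`Σ_{k,l} (Perm_σ)_{kl} x_k y_l = Σ_k x_k y_{σ k}`), **`sum_mul_mul_le_of_mem_doublyStochastic`** (the trace rearrangement inequality),
  `sq_mem_doublyStochastic_of_mul_transpose` (orthogonal ⇒ squared entries doubly stochastic), **`sum_sq_mul_mul_le_of_orthogonal`**.
CAVEATS.  Index type `Fin n` with the natural order (so «increasing» is `Monotone`).  Nothing Ext-side.  New names only.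
-/

open Module Polynomial
open scoped Matrix Polynomial

namespace Summit.Ventures.HSemireg.Wedge.HankelOuter

/-! ## §1180. Doubly stochastic trace rearrangement -/

/-- `Σ_{k,l} (Perm_σ)_{kl} x_k y_l = Σ_k x_k y_{σ k}`. [bookkeeping; this file, §1180] -/
theorem sum_permMatrix_mul_mul {n : ℕ} (σ : Equiv.Perm (Fin n)) (x y : Fin n → ℝ) :
    ∑ k, ∑ l, (σ.permMatrix ℝ) k l * (x k * y l) = ∑ k, x k * y (σ k) := by
  refine Finset.sum_congr rfl fun k _ => ?_
  rw [Finset.sum_eq_single (σ k)]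
  · rw [Equiv.Perm.permMatrix, PEquiv.toMatrix_apply, Equiv.toPEquiv_apply, if_pos (Option.mem_some_iff.2 rfl), one_mul]
  · intro l _ hl
    rw [Equiv.Perm.permMatrix, PEquiv.toMatrix_apply, Equiv.toPEquiv_apply, if_neg (fun h => hl (Option.mem_some_iff.1 h).symm), zero_mul]
  · intro h; exact absurd (Finset.mem_univ _) h

/-- **THE TRACE REARRANGEMENT INEQUALITY: `P` doubly stochastic, `x`, `y` increasing ⇒ `Σ_{k,l} P_{kl} x_k y_l ≤ Σ_k x_k y_k`.** [Hoffman–Wielandt 1953 (via Birkhoff 1946); Hardy–Littlewood–Pólya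
Thm 368; Bhatia Problem III.6.14; this file, §1180] -/
theorem sum_mul_mul_le_of_mem_doublyStochastic {n : ℕ} {x y : Fin n → ℝ} (hx : Monotone x) (hy : Monotone y) {P : Matrix (Fin n) (Fin n) ℝ}
    (hP : P ∈ doublyStochastic ℝ (Fin n)) : ∑ k, ∑ l, P k l * (x k * y l) ≤ ∑ k, x k * y k := by
  obtain ⟨w, hw0, hw1, hwP⟩ := exists_eq_sum_perm_of_mem_doublyStochastic hP
  have hexp : ∑ k, ∑ l, P k l * (x k * y l) = ∑ σ, w σ * ∑ k, x k * y (σ k) := by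
    rw [← hwP]
    have hkl : ∀ k l, (∑ σ, w σ • σ.permMatrix ℝ) k l * (x k * y l) = ∑ σ, w σ * ((σ.permMatrix ℝ) k l * (x k * y l)) := fun k l => by
      rw [Matrix.sum_apply, Finset.sum_mul]
      exact Finset.sum_congr rfl fun σ _ => by rw [Matrix.smul_apply, smul_eq_mul, mul_assoc]
    simp_rw [hkl]
    rw [Finset.sum_congr rfl fun k _ => Finset.sum_comm, Finset.sum_comm]
    refine Finset.sum_congr rfl fun σ _ => ?_
    rw [← sum_permMatrix_mul_mul σ x y, Finset.mul_sum]
    exact Finset.sum_congr rfl fun k _ => by rw [Finset.mul_sum]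
  rw [hexp]
  calc ∑ σ, w σ * ∑ k, x k * y (σ k) ≤ ∑ σ, w σ * ∑ k, x k * y k :=
        Finset.sum_le_sum fun σ _ => mul_le_mul_of_nonneg_left ((hx.monovary hy).sum_mul_comp_perm_le_sum_mul) (hw0 σ)
    _ = ∑ k, x k * y k := by rw [← Finset.sum_mul, hw1, one_mul]

/-- **For an orthogonal matrix `M` (`M Mᵀ = 1` and `Mᵀ M = 1`) the matrix of squared entries is doubly stochastic.** [Hoffman–Wielandt 1953; this file, §1180] -/
theorem sq_mem_doublyStochastic_of_mul_transpose {n : ℕ} {M : Matrix (Fin n) (Fin n) ℝ} (h1 : M * Mᵀ = 1) (h2 : Mᵀ * M = 1) :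
    Matrix.of (fun k l => M k l ^ 2) ∈ doublyStochastic ℝ (Fin n) := by
  rw [mem_doublyStochastic_iff_sum]
  refine ⟨fun k l => by rw [Matrix.of_apply]; exact sq_nonneg _, fun k => ?_, fun l => ?_⟩
  · have h := congr_fun (congr_fun h1 k) k
    rw [Matrix.mul_apply, Matrix.one_apply_eq] at h
    rw [← h]
    exact Finset.sum_congr rfl fun l _ => by rw [Matrix.of_apply, Matrix.transpose_apply, sq]
  · have h := congr_fun (congr_fun h2 l) l
    rw [Matrix.mul_apply, Matrix.one_apply_eq] at h
    rw [← h]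
    exact Finset.sum_congr rfl fun k _ => by rw [Matrix.of_apply, Matrix.transpose_apply, sq]

/-- **`Σ_{k,l} M_{kl}² x_k y_l ≤ Σ_k x_k y_k` for orthogonal `M` and increasing `x, y`.** [Hoffman–Wielandt 1953; Wilkinson Ch. 2 §48; this file, §1180] -/
theorem sum_sq_mul_mul_le_of_orthogonal {n : ℕ} {x y : Fin n → ℝ} (hx : Monotone x) (hy : Monotone y) {M : Matrix (Fin n) (Fin n) ℝ} (h1 : M * Mᵀ = 1) (h2 : Mᵀ * M = 1) :
    ∑ k, ∑ l, M k l ^ 2 * (x k * y l) ≤ ∑ k, x k * y k := by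
  have h := sum_mul_mul_le_of_mem_doublyStochastic hx hy (sq_mem_doublyStochastic_of_mul_transpose h1 h2)
  simpa only [Matrix.of_apply] using h

end Summit.Ventures.HSemireg.Wedge.HankelOuter
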